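import Summits.HodgeConjecture.HodgeCM.Automorphic.WeilThetaModelHeisenberg_1

/-! PORT of `HodgeCM/Automorphic/WeilThetaModelHeisenberg.lean` (HodgeCMPerL run 82) — part 2: continuation of `Summits.HodgeConjecture.HodgeCM.Automorphic.WeilThetaModelHeisenberg_1` (split at a top-level declaration boundary by port_pkg.py; scope re-opened below; declarations unchanged). -/

-- port_pkg: scope re-opened for this part (file-level context, then the namespace/section stack open at the cut)
set_option autoImplicit false
noncomputable section
open MeasureTheory
open scoped RealInnerProductSpace FourierTransform SchwartzMap
namespace HodgeCM
namespace SchwartzWeil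
section Arith
variable (V : Type) [NormedAddCommGroup V] [InnerProductSpace ℝ V] (L : Submodule ℤ V) (m : ℤ)

/-- **The arithmetic subgroup** `{(a, b, u) : a ∈ L, m b ∈ L*, u^m = 1}` of the Heisenberg group — Weil's
`Ps(X)_k ∩` (Heisenberg group) [We64 n° 41], both halves `X_k` and `X_k^*`.  (No full-rank hypothesis on `L` is
needed: `L* = {w : ⟪w, L⟫ ⊆ ℤ}`.) -/
def arith : Subgroup (Heis V) where
  carrier := {h | h.a ∈ L ∧ (m : ℝ) • h.b ∈ PoissonSummation.dualLattice L ∧ h.u ^ m = 1}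
  mul_mem' := by
    rintro h h' ⟨ha, hb, hu⟩ ⟨ha', hb', hu'⟩
    refine ⟨?_, ?_, ?_⟩
    · simpa only [Heis.mul_a] using L.add_mem ha ha'
    · simpa only [Heis.mul_b, smul_add] using (PoissonSummation.dualLattice L).add_mem hb hb'
    · rw [Heis.mul_u, mul_zpow, mul_zpow, hu, hu', fourierChar_cocycle_zpow_eq_one V L m ha hb', one_mul, one_mul]
  one_mem' := by
    refine ⟨?_, ?_, ?_⟩
    · simpa only [Heis.one_a] using L.zero_mem
    · simpa only [Heis.one_b, smul_zero] using (PoissonSummation.dualLattice L).zero_mem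
    · rw [Heis.one_u, one_zpow]
  inv_mem' := by
    rintro h ⟨ha, hb, hu⟩
    refine ⟨?_, ?_, ?_⟩
    · simpa only [Heis.inv_a] using L.neg_mem ha
    · simpa only [Heis.inv_b, smul_neg] using (PoissonSummation.dualLattice L).neg_mem hb
    · rw [Heis.inv_u, mul_zpow, inv_zpow, hu, inv_one, one_mul, fourierChar_cocycle_zpow_eq_one V L m ha hb]

/-- (Ported verbatim from the HodgeCMPerL package; no docstring in the source.) -/
theorem mem_arith {h : Heis V} :
    h ∈ arith V L m ↔ h.a ∈ L ∧ (m : ℝ) • h.b ∈ PoissonSummation.dualLattice L ∧ h.u ^ m = 1 :=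
  Iff.rfl

/-- (Ported verbatim from the HodgeCMPerL package; no docstring in the source.) -/
theorem center_mem_arith {z : Circle} (hz : z ^ m = 1) : Heis.center z ∈ arith V L m := by
  refine ⟨?_, ?_, ?_⟩
  · simpa only [Heis.center_a] using L.zero_mem
  · simpa only [Heis.center_b, smul_zero] using (PoissonSummation.dualLattice L).zero_mem
  · simpa only [Heis.center_u] using hz

end Arith

section Invariance

variable (V : Type) [NormedAddCommGroup V] [InnerProductSpace ℝ V] [FiniteDimensional ℝ V] [MeasurableSpace V]
  [BorelSpace V] (L : Submodule ℤ V) (m : ℤ)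

omit [FiniteDimensional ℝ V] [MeasurableSpace V] [BorelSpace V] in
/-- pv14-g4's arithmetic set `rat = {(a, u) : a ∈ L, u^m = 1}` is the `b = 0` part of `arith`. -/
theorem ofSchrodinger_mem_arith {S : Multiplicative V × Circle} :
    Heis.ofSchrodinger S ∈ arith V L m ↔ S ∈ rat V L m := by
  rw [mem_arith, mem_rat]
  simp only [Heis.ofSchrodinger_a, Heis.ofSchrodinger_b, Heis.ofSchrodinger_u, smul_zero,
    (PoissonSummation.dualLattice L).zero_mem, true_and]

/-- An arithmetic element does not change the lattice sum: `Σ_{v ∈ L} (ρ_m(γ) Ψ)(v) = Σ_{v ∈ L} Ψ(v)` —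
`u^m = 1`, `𝐞(m⟪b, v⟫) = 1` on `L` (duality, #4 `fourierChar_inner_eq_one_of_mem_dualLattice`), and
`v ↦ v - a` permutes `L`. -/
theorem tsum_repCLM_of_mem_arith (Ψ : 𝓢(V, ℂ)) {γ : Heis V} (hγ : γ ∈ arith V L m) :
    ∑' v : L, repCLM V m γ Ψ (v : V) = ∑' v : L, Ψ (v : V) := by
  obtain ⟨ha, hb, hu⟩ := hγ
  have hu' : (γ.u : ℂ) ^ m = 1 := by rw [← Circle.coe_zpow, hu, Circle.coe_one]
  simp only [repCLM_apply, hu', one_mul, fourierChar_inner_eq_one_of_mem_dualLattice V L hb, Circle.coe_one]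
  have h := PerL34.LatticeTheta.tsum_translate_add_mem L Ψ 0 (-⟨γ.a, ha⟩)
  simp only [zero_add, Submodule.coe_neg] at h
  simpa only [sub_eq_neg_add] using h

/-- **Arithmetic invariance (Weil's Théorème 6 in the model, full Heisenberg group)**:
`Θ_Φ(γ h) = Θ_Φ(h)` for `γ ∈ arith`. -/
theorem thetaH_arith_mul (Φ : 𝓢(V, ℂ)) {γ : Heis V} (hγ : γ ∈ arith V L m) (h : Heis V) :
    thetaH V L m Φ (γ * h) = thetaH V L m Φ h := by
  rw [← thetaH_repCLM V L m Φ γ h, thetaH, thetaH, tsum_repCLM_of_mem_arith V L m _ hγ]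

variable [DiscreteTopology L]

/-- (Ported verbatim from the HodgeCMPerL package; no docstring in the source.) -/
theorem thetaH_eq_thetaCLM (Φ : 𝓢(V, ℂ)) (h : Heis V) :
    thetaH V L m Φ h = thetaCLM L (0 : V) (repCLM V m h Φ) := by
  simp only [thetaH, thetaCLM_apply, zero_add]

/-- Joint continuity of `(Φ, h) ↦ Θ_Φ(h)` (`L` discrete). -/
theorem continuous_thetaH_uncurry : Continuous (Function.uncurry (thetaH V L m)) := by
  have h := (thetaCLM L (0 : V) (E := V) (F := ℂ)).continuous.comp
    ((continuous_repCLM_uncurry V m).comp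
      ((continuous_snd (X := 𝓢(V, ℂ)) (Y := Heis V)).prodMk (continuous_fst (X := 𝓢(V, ℂ)) (Y := Heis V))))
  simp only [Function.comp_def, Function.uncurry_def] at h
  simp only [Function.uncurry_def, thetaH_eq_thetaCLM]
  exact h

/-- (Ported verbatim from the HodgeCMPerL package; no docstring in the source.) -/
theorem continuous_thetaH (Φ : 𝓢(V, ℂ)) : Continuous (thetaH V L m Φ) := by
  have h := (continuous_thetaH_uncurry V L m).comp
    ((continuous_const (y := Φ)).prodMk (continuous_id (X := Heis V)))
  simp only [Function.comp_def, Function.uncurry_def, id] at h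
  exact h

/-- (Ported verbatim from the HodgeCMPerL package; no docstring in the source.) -/
theorem continuous_thetaH_left (h : Heis V) : Continuous fun Φ : 𝓢(V, ℂ) => thetaH V L m Φ h := by
  have h' := (continuous_thetaH_uncurry V L m).comp
    ((continuous_id (X := 𝓢(V, ℂ))).prodMk (continuous_const (y := h)))
  simp only [Function.comp_def, Function.uncurry_def, id] at h'
  exact h'

/-- Non-degeneracy: some `Φ` has `Θ_Φ(1) = 1` (pv14-g4 `exists_theta_one_eq_one`). -/
theorem exists_thetaH_one_eq_one : ∃ Φ : 𝓢(V, ℂ), thetaH V L m Φ 1 = 1 := by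
  obtain ⟨Φ, hΦ⟩ := exists_theta_one_eq_one V L m
  refine ⟨Φ, ?_⟩
  rw [← hΦ, ← thetaH_ofSchrodinger V L m Φ 1, map_one]

end Invariance

/-! ## 4. The datum and the `WeilThetaModel` over the Heisenberg group -/

section Model

variable (V : Type) [NormedAddCommGroup V] [InnerProductSpace ℝ V] [FiniteDimensional ℝ V] [MeasurableSpace V]
  [BorelSpace V] (L : Submodule ℤ V) (m : ℤ)

/-- The Schrödinger–Heisenberg–lattice `WeilThetaDatum`: `Mp := Heis V`, `SX := 𝓢(V, ℂ)`, `act := ρ_m`,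
`rat := arith`, `theta := Θ`. -/
def datumH : Literature.Theta.WeilThetaDatum.{0} where
  Mp := Heis V
  SX := 𝓢(V, ℂ)
  act := fun h Φ => repCLM V m h Φ
  rat := (arith V L m : Set (Heis V))
  theta := thetaH V L m

/-- (Ported verbatim from the HodgeCMPerL package; no docstring in the source.) -/
@[simp] theorem datumH_Mp : (datumH V L m).Mp = Heis V := rfl
/-- (Ported verbatim from the HodgeCMPerL package; no docstring in the source.) -/
@[simp] theorem datumH_SX : (datumH V L m).SX = 𝓢(V, ℂ) := rfl
/-- (Ported verbatim from the HodgeCMPerL package; no docstring in the source.) -/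
theorem datumH_act (h : Heis V) (Φ : 𝓢(V, ℂ)) : (datumH V L m).act h Φ = repCLM V m h Φ := rfl
/-- (Ported verbatim from the HodgeCMPerL package; no docstring in the source.) -/
theorem datumH_theta : (datumH V L m).theta = thetaH V L m := rfl
/-- (Ported verbatim from the HodgeCMPerL package; no docstring in the source.) -/
theorem datumH_rat : (datumH V L m).rat = (arith V L m : Set (Heis V)) := rfl

/-- (Ported verbatim from the HodgeCMPerL package; no docstring in the source.) -/
theorem actionContinuousH : (datumH V L m).ActionContinuous := continuous_repCLM_uncurry V m

variable [DiscreteTopology L]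

/-- (Ported verbatim from the HodgeCMPerL package; no docstring in the source.) -/
theorem thetaContinuousInvariantH : (datumH V L m).ThetaContinuousInvariant :=
  ⟨continuous_thetaH V L m, fun Φ _ hγ S => thetaH_arith_mul V L m Φ hγ S⟩

/-- **The Schrödinger–Heisenberg–lattice Weil theta model.**  For a discrete subgroup `L` (e.g. a full-rank lattice)
of a finite-dimensional real inner product space `V`, a weight `m : ℤ` and a subgroup `Γ ≤ U(1)` of `m`-th roots of unity, prl1-g4's
`WeilThetaModel (Heis V) (arith V L m) U(1) Γ` with every field a theorem: the datum is `datumH`, the splitting is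
`(h, z) ↦ h c(z)`, `SK := univ`. -/
def heisenbergModel (Γ : Subgroup Circle) (hΓ : ∀ u ∈ Γ, u ^ m = 1) :
    HodgeCM.WeilThetaModel (Heis V) (arith V L m) Circle Γ where
  W := datumH V L m
  act_one := repCLM_one_apply V m
  theta_act := thetaH_repCLM V L m
  actionContinuous := actionContinuousH V L m
  thetaContinuousInvariant := thetaContinuousInvariantH V L m
  dist_cont := continuous_thetaH_left V L m 1
  s := Heis.splitting
  s_cont := Heis.continuous_splitting
  s_rat := fun _ hγU _ hγ => (arith V L m).mul_mem hγU (center_mem_arith V L m (hΓ _ hγ))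
  SK := Set.univ
  SK_stable := fun _ _ _ => Set.mem_univ _

/-- (Ported verbatim from the HodgeCMPerL package; no docstring in the source.) -/
@[simp] theorem heisenbergModel_W (Γ : Subgroup Circle) (hΓ : ∀ u ∈ Γ, u ^ m = 1) :
    (heisenbergModel V L m Γ hΓ).W = datumH V L m := rfl

/-- (Ported verbatim from the HodgeCMPerL package; no docstring in the source.) -/
@[simp] theorem heisenbergModel_SK (Γ : Subgroup Circle) (hΓ : ∀ u ∈ Γ, u ^ m = 1) :
    (heisenbergModel V L m Γ hΓ).SK = Set.univ := rfl

/-- (Ported verbatim from the HodgeCMPerL package; no docstring in the source.) -/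
@[simp] theorem heisenbergModel_s_apply (Γ : Subgroup Circle) (hΓ : ∀ u ∈ Γ, u ^ m = 1) (p : Heis V × Circle) :
    (heisenbergModel V L m Γ hΓ).s p = p.1 * Heis.center p.2 := rfl

/-- The model's theta kernel on representatives: `θ_Φ(h·arith, z Γ) = Θ_Φ(h⁻¹ c(z⁻¹)) = Θ_Φ((h c(z))⁻¹)`. -/
theorem heisenbergModel_θ_mk (Γ : Subgroup Circle) (hΓ : ∀ u ∈ Γ, u ^ m = 1) (Φ : 𝓢(V, ℂ)) (h : Heis V)
    (z : Circle) :
    (heisenbergModel V L m Γ hΓ).θ ⟨Φ, Set.mem_univ Φ⟩ (QuotientGroup.mk h, QuotientGroup.mk z) =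
      thetaH V L m Φ (h⁻¹ * Heis.center z⁻¹) := by
  rw [WeilThetaModel.θ_mk]
  rfl

/-- (Ported verbatim from the HodgeCMPerL package; no docstring in the source.) -/
theorem heisenbergModel_θ_mk' (Γ : Subgroup Circle) (hΓ : ∀ u ∈ Γ, u ^ m = 1) (Φ : 𝓢(V, ℂ)) (h : Heis V)
    (z : Circle) :
    (heisenbergModel V L m Γ hΓ).θ ⟨Φ, Set.mem_univ Φ⟩ (QuotientGroup.mk h, QuotientGroup.mk z) =
      thetaH V L m Φ (h * Heis.center z)⁻¹ := by
  rw [heisenbergModel_θ_mk, mul_inv_rev, ← map_inv, Heis.center_mul_comm]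

/-- Explicitly: `θ_Φ(h·arith, zΓ) = z^{-m} u^{-m} 𝐞(-m⟪a, b⟫) Σ_{v ∈ L} 𝐞(-m⟪b, v⟫) Φ(v + a)` for `h = (a, b, u)`. -/
theorem heisenbergModel_θ_mk_eq (Γ : Subgroup Circle) (hΓ : ∀ u ∈ Γ, u ^ m = 1) (Φ : 𝓢(V, ℂ)) (h : Heis V)
    (z : Circle) :
    (heisenbergModel V L m Γ hΓ).θ ⟨Φ, Set.mem_univ Φ⟩ (QuotientGroup.mk h, QuotientGroup.mk z) =
      ((h.u : ℂ) ^ m)⁻¹ * ((z : ℂ) ^ m)⁻¹ * ((𝐞 (-⟪h.a, h.b⟫) : Circle) : ℂ) ^ m *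
        ∑' v : L, (𝐞 (-⟪(m : ℝ) • h.b, (v : V)⟫) : ℂ) * Φ ((v : V) + h.a) := by
  rw [heisenbergModel_θ_mk, thetaH_eq]
  simp only [Heis.mul_u, Heis.mul_a, Heis.mul_b, Heis.inv_u, Heis.inv_a, Heis.inv_b, Heis.center_u,
    Heis.center_a, Heis.center_b, inner_zero_right, neg_zero, AddChar.map_zero_eq_one, mul_one, add_zero,
    Circle.coe_mul, Circle.coe_inv, mul_zpow, inv_zpow, smul_neg, inner_neg_left, sub_neg_eq_add]
  ring

/-- Non-degeneracy survives the descent. -/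
theorem heisenbergModel_θ_ne_zero (Γ : Subgroup Circle) (hΓ : ∀ u ∈ Γ, u ^ m = 1) :
    ∃ Φ : (heisenbergModel V L m Γ hΓ).SK,
      (heisenbergModel V L m Γ hΓ).θ Φ (QuotientGroup.mk 1, QuotientGroup.mk 1) ≠ 0 := by
  obtain ⟨Φ, hΦ⟩ := exists_thetaH_one_eq_one V L m
  refine ⟨⟨Φ, Set.mem_univ _⟩, ?_⟩
  rw [heisenbergModel_θ_mk, inv_one, inv_one, map_one, mul_one, hΦ]
  exact one_ne_zero

/-- The three structural laws of prl1-g4's record, now theorems of the Heisenberg model. -/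
theorem heisenbergModel_structural_laws (Γ : Subgroup Circle) (hΓ : ∀ u ∈ Γ, u ^ m = 1) :
    (∀ Φ : (heisenbergModel V L m Γ hΓ).SK, (heisenbergModel V L m Γ hΓ).omg 1 Φ = Φ) ∧
      Continuous (heisenbergModel V L m Γ hΓ).θ ∧
      ∀ (z : Circle) (Φ : (heisenbergModel V L m Γ hΓ).SK) (ξ : Heis V ⧸ arith V L m) (q : Circle ⧸ Γ),
        (heisenbergModel V L m Γ hΓ).θ ((heisenbergModel V L m Γ hΓ).omg z Φ) (ξ, q) =
          (heisenbergModel V L m Γ hΓ).θ Φ (ξ, z⁻¹ • q) :=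
  (heisenbergModel V L m Γ hΓ).structural_laws

end Model

end SchwartzWeil
end HodgeCM

end
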